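import Mathlib
import HarnessLib

/-!
# LINE g7-δ «member selection», T1 tool: THE SELECTION ALGEBRA (Cauchy–Schwarz shares + choice of an efficient core)

Crux `NearExtremalTransiencePerFlow` (stmt-NavierStokesRegularity-26567), line δ `member_selection`, stub T1
`stub_coherentSelection` (critic idea-crit-4 N1, quantitative form): with pieces `p` (cores, far cores, collars) of a
partition, budgets `Z_p, P_p ≥ 0` summing to at most `Z, P`, stretching pieces `|J_p| ≤ e_p · M · √(Z_p P_p)` (`e_p ≥ 0`
the efficiency of the piece at the GLOBAL height `M`) and the global near-extremality `κ · M · √(Z P) ≤ |J| ≤ Σ_p |J_p|`,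
one has (I1) `κ √(ZP) ≤ Σ_p e_p √(Z_p P_p)` where the CS-weights satisfy `Σ_p √(Z_p P_p) ≤ √(ZP)` (Cauchy–Schwarz);
hence, if the BAD pieces (far cores, collars) obey an a-priori bound `e_p ≤ E` and have total weight `≤ σ √(ZP)`, SOME
GOOD piece is `(κ − Eσ)`-efficient.  The weight of the far cores is the landed `MemberSelection.share_le_of_taylor`
(`σ_far = √Θ/L₁`); the weight of the collars is `≤ √(δδ')·√(ZP)` when they carry at most `δZ` and `δ'P`
(`sum_sqrt_mul_le_of_sum_le`; the landed collar pigeonhole `exists_gridCollar_integral_le` supplies `δ = δ'`).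

* `sum_sqrt_mul_le_sqrt_mul_sqrt` — `Σ √(Z_p P_p) ≤ √(Σ Z_p) √(Σ P_p)`;
* `sum_sqrt_mul_le_of_sum_le` — `Σ_bad √(Z_p P_p) ≤ √(δδ') √(ZP)` if `Σ_bad Z_p ≤ δZ`, `Σ_bad P_p ≤ δ'P`;
* `exists_ge_of_sum_mul_le` — max selection: weights `w ≥ 0` with `Σ_s w ≤ W`, `e ≥ 0` on `good`, `e ≤ E` off `good`,
  `κ W ≤ Σ_s e w` ⇒ `∃ p ∈ good, κ W − E Σ_{s∖good} w ≤ e_p W`;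
* `exists_efficient_good_piece` — the assembled selection step (I1)+(I2)-shape: `∃ p ∈ good,
  (κ − Eσ) · M · √(Z_p P_p) ≤ |J_p|`… stated as `κ − E σ ≤ e_p`.

Pure finite algebra over `ℝ`; nothing here is a statement about Navier–Stokes. 26567, T1, T3, NS regularity OPEN.
No summit is proved by a line.
-/

noncomputable section

open Finset

namespace Summit.NavierStokesRegularity.NavierStokesRegularity.Theorems.NearExtremalTransiencePerFlow.MemberSelection

set_option linter.dupNamespace false

variable {ι : Type*}

/-! ### Cauchy–Schwarz for the weights -/

/-- `Σ_p √(Z_p P_p) ≤ √(Σ_p Z_p) · √(Σ_p P_p)` for non-negative budgets. [folklore] -/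
theorem sum_sqrt_mul_le_sqrt_mul_sqrt (s : Finset ι) (Zc Pc : ι → ℝ) (hZ : ∀ i ∈ s, 0 ≤ Zc i)
    (hP : ∀ i ∈ s, 0 ≤ Pc i) :
    ∑ i ∈ s, Real.sqrt (Zc i * Pc i) ≤ Real.sqrt (∑ i ∈ s, Zc i) * Real.sqrt (∑ i ∈ s, Pc i) := by
  have h1 : ∑ i ∈ s, Real.sqrt (Zc i * Pc i) = ∑ i ∈ s, Real.sqrt (Zc i) * Real.sqrt (Pc i) :=
    Finset.sum_congr rfl fun i hi => Real.sqrt_mul (hZ i hi) _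
  rw [h1]
  -- Cauchy–Schwarz `(Σ a b)² ≤ (Σ a²)(Σ b²)` with `a = √Z_p`, `b = √P_p`
  have hcs := Finset.sum_mul_sq_le_sq_mul_sq s (fun i => Real.sqrt (Zc i)) (fun i => Real.sqrt (Pc i))
  have hZ2 : ∑ i ∈ s, Real.sqrt (Zc i) ^ 2 = ∑ i ∈ s, Zc i :=
    Finset.sum_congr rfl fun i hi => Real.sq_sqrt (hZ i hi)
  have hP2 : ∑ i ∈ s, Real.sqrt (Pc i) ^ 2 = ∑ i ∈ s, Pc i :=
    Finset.sum_congr rfl fun i hi => Real.sq_sqrt (hP i hi)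
  rw [hZ2, hP2] at hcs
  have hS0 : 0 ≤ ∑ i ∈ s, Real.sqrt (Zc i) * Real.sqrt (Pc i) :=
    Finset.sum_nonneg fun i _ => mul_nonneg (Real.sqrt_nonneg _) (Real.sqrt_nonneg _)
  have hZs : 0 ≤ ∑ i ∈ s, Zc i := Finset.sum_nonneg hZ
  rw [← Real.sqrt_mul hZs, ← Real.sqrt_sq hS0]
  exact Real.sqrt_le_sqrt hcs

/-- **Weight of a cheap sub-family**: if `Σ_bad Z_p ≤ δ Z` and `Σ_bad P_p ≤ δ' P` (`Z, δ, δ' ≥ 0`), then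
`Σ_bad √(Z_p P_p) ≤ √(δ δ') · √(Z P)` (collars cheap in both budgets have small weight). [folklore] -/
theorem sum_sqrt_mul_le_of_sum_le (bad : Finset ι) (Zc Pc : ι → ℝ) {Z P δ δ' : ℝ} (hZ : ∀ i ∈ bad, 0 ≤ Zc i)
    (hP : ∀ i ∈ bad, 0 ≤ Pc i) (hδ : 0 ≤ δ) (hδ' : 0 ≤ δ') (hZ0 : 0 ≤ Z)
    (hZle : ∑ i ∈ bad, Zc i ≤ δ * Z) (hPle : ∑ i ∈ bad, Pc i ≤ δ' * P) :
    ∑ i ∈ bad, Real.sqrt (Zc i * Pc i) ≤ Real.sqrt (δ * δ') * Real.sqrt (Z * P) := by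
  calc ∑ i ∈ bad, Real.sqrt (Zc i * Pc i)
      ≤ Real.sqrt (∑ i ∈ bad, Zc i) * Real.sqrt (∑ i ∈ bad, Pc i) := sum_sqrt_mul_le_sqrt_mul_sqrt bad Zc Pc hZ hP
    _ ≤ Real.sqrt (δ * Z) * Real.sqrt (δ' * P) :=
        mul_le_mul (Real.sqrt_le_sqrt hZle) (Real.sqrt_le_sqrt hPle) (Real.sqrt_nonneg _) (Real.sqrt_nonneg _)
    _ = Real.sqrt (δ * Z * (δ' * P)) := (Real.sqrt_mul (mul_nonneg hδ hZ0) _).symm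
    _ = Real.sqrt (δ * δ' * (Z * P)) := by ring_nf
    _ = Real.sqrt (δ * δ') * Real.sqrt (Z * P) := Real.sqrt_mul (mul_nonneg hδ hδ') _

/-! ### Choice of an efficient good piece -/

/-- **Max selection.** Weights `w ≥ 0` on `s` with `Σ_s w ≤ W`, efficiencies `e ≥ 0` on the non-empty sub-family
`good ⊆ s` and `e ≤ E` off `good`; if `κ W ≤ Σ_s e w` then some good piece has
`κ W − E Σ_{s∖good} w ≤ e_p W`. [folklore] -/
theorem exists_ge_of_sum_mul_le [DecidableEq ι] (s good : Finset ι) (hsub : good ⊆ s) (hgood : good.Nonempty) (e w : ι → ℝ)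
    {κ E W : ℝ} (hw0 : ∀ i ∈ s, 0 ≤ w i) (hw1 : ∑ i ∈ s, w i ≤ W) (he0 : ∀ i ∈ good, 0 ≤ e i)
    (hE : ∀ i ∈ s, i ∉ good → e i ≤ E) (hκ : κ * W ≤ ∑ i ∈ s, e i * w i) :
    ∃ p ∈ good, κ * W - E * ∑ i ∈ s \ good, w i ≤ e p * W := by
  -- the best good piece
  obtain ⟨p, hp, hmax⟩ := Finset.exists_max_image good e hgood
  refine ⟨p, hp, ?_⟩
  have hsplit : ∑ i ∈ s, e i * w i = ∑ i ∈ good, e i * w i + ∑ i ∈ s \ good, e i * w i := by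
    rw [← Finset.sum_union (Finset.disjoint_sdiff), Finset.union_sdiff_of_subset hsub]
  have hwsplit : ∑ i ∈ s, w i = ∑ i ∈ good, w i + ∑ i ∈ s \ good, w i := by
    rw [← Finset.sum_union (Finset.disjoint_sdiff), Finset.union_sdiff_of_subset hsub]
  -- good part ≤ e_p · Σ_good w
  have hgood_le : ∑ i ∈ good, e i * w i ≤ e p * ∑ i ∈ good, w i := by
    rw [Finset.mul_sum]
    exact Finset.sum_le_sum fun i hi => mul_le_mul_of_nonneg_right (hmax i hi) (hw0 i (hsub hi))
  -- bad part ≤ E · Σ_bad w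
  have hbad_le : ∑ i ∈ s \ good, e i * w i ≤ E * ∑ i ∈ s \ good, w i := by
    rw [Finset.mul_sum]
    refine Finset.sum_le_sum fun i hi => ?_
    have his : i ∈ s := Finset.sdiff_subset hi
    have hig : i ∉ good := (Finset.mem_sdiff.1 hi).2
    exact mul_le_mul_of_nonneg_right (hE i his hig) (hw0 i his)
  -- `Σ_good w ≤ W`, and `e_p ≥ 0`
  have hbad0 : 0 ≤ ∑ i ∈ s \ good, w i := Finset.sum_nonneg fun i hi => hw0 i (Finset.sdiff_subset hi)
  have hgoodW : ∑ i ∈ good, w i ≤ W := by linarith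
  have hep : 0 ≤ e p := he0 p hp
  calc κ * W - E * ∑ i ∈ s \ good, w i
      ≤ ∑ i ∈ good, e i * w i := by linarith
    _ ≤ e p * ∑ i ∈ good, w i := hgood_le
    _ ≤ e p * W := mul_le_mul_of_nonneg_left hgoodW hep

/-- **The selection step of T1, assembled** (I1 + weights): pieces `p ∈ s` with budgets `Z_p, P_p ≥ 0`, efficiencies
`e_p ≥ 0` at the global height `M > 0` (`|J_p| ≤ e_p · M · √(Z_p P_p)`), GOOD pieces `good ⊆ s` (non-empty) and an
a-priori bound `e_p ≤ E` on the others, whose total CS-weight is `Σ_{s∖good} √(Z_p P_p) ≤ σ · √(Z P)`; if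
`Σ_s Z_p ≤ Z`, `Σ_s P_p ≤ P`, `0 < Z P` and the whole slice is `κ`-efficient in the sense
`κ · M · √(Z P) ≤ Σ_s |J_p|`, then some good piece is `(κ − E σ)`-efficient: `κ − E σ ≤ e_p`. [folklore] -/
theorem exists_efficient_good_piece [DecidableEq ι] (s good : Finset ι) (hsub : good ⊆ s) (hgood : good.Nonempty)
    (J e Zc Pc : ι → ℝ) {κ E σ M Z P : ℝ} (hM : 0 < M) (hZP : 0 < Z * P)
    (hZc : ∀ i ∈ s, 0 ≤ Zc i) (hPc : ∀ i ∈ s, 0 ≤ Pc i)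
    (hZ : ∑ i ∈ s, Zc i ≤ Z) (hP : ∑ i ∈ s, Pc i ≤ P)
    (he0 : ∀ i ∈ s, 0 ≤ e i) (hJ : ∀ i ∈ s, |J i| ≤ e i * M * Real.sqrt (Zc i * Pc i))
    (hE : ∀ i ∈ s, i ∉ good → e i ≤ E) (hE0 : 0 ≤ E)
    (hσ : ∑ i ∈ s \ good, Real.sqrt (Zc i * Pc i) ≤ σ * Real.sqrt (Z * P))
    (hκ : κ * M * Real.sqrt (Z * P) ≤ ∑ i ∈ s, |J i|) :
    ∃ p ∈ good, κ - E * σ ≤ e p := by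
  have hW : 0 < Real.sqrt (Z * P) := Real.sqrt_pos.2 hZP
  have hZ0 : 0 ≤ Z := by
    by_contra hneg
    push Not at hneg
    have hPs : 0 ≤ P := (Finset.sum_nonneg hPc).trans hP
    have : Z * P ≤ 0 := mul_nonpos_of_nonpos_of_nonneg hneg.le hPs
    linarith
  -- weights `w_p = √(Z_p P_p)`, total `≤ √(Z P)`
  have hw1 : ∑ i ∈ s, Real.sqrt (Zc i * Pc i) ≤ Real.sqrt (Z * P) := by
    calc ∑ i ∈ s, Real.sqrt (Zc i * Pc i) ≤ Real.sqrt (∑ i ∈ s, Zc i) * Real.sqrt (∑ i ∈ s, Pc i) :=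
          sum_sqrt_mul_le_sqrt_mul_sqrt s Zc Pc hZc hPc
      _ ≤ Real.sqrt Z * Real.sqrt P :=
          mul_le_mul (Real.sqrt_le_sqrt hZ) (Real.sqrt_le_sqrt hP) (Real.sqrt_nonneg _) (Real.sqrt_nonneg _)
      _ = Real.sqrt (Z * P) := (Real.sqrt_mul hZ0 P).symm
  -- (I1): `κ √(ZP) ≤ Σ e_p w_p` (divide the stretching bound by `M`)
  have hκW : κ * Real.sqrt (Z * P) ≤ ∑ i ∈ s, e i * Real.sqrt (Zc i * Pc i) := by
    have h1 : ∑ i ∈ s, |J i| ≤ ∑ i ∈ s, e i * M * Real.sqrt (Zc i * Pc i) := Finset.sum_le_sum hJ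
    have h2 : ∑ i ∈ s, e i * M * Real.sqrt (Zc i * Pc i) = M * ∑ i ∈ s, e i * Real.sqrt (Zc i * Pc i) := by
      rw [Finset.mul_sum]; exact Finset.sum_congr rfl fun i _ => by ring
    have h3 : M * (κ * Real.sqrt (Z * P)) ≤ M * ∑ i ∈ s, e i * Real.sqrt (Zc i * Pc i) := by
      calc M * (κ * Real.sqrt (Z * P)) = κ * M * Real.sqrt (Z * P) := by ring
        _ ≤ ∑ i ∈ s, |J i| := hκ
        _ ≤ _ := h1
        _ = _ := h2
    exact le_of_mul_le_mul_left h3 hM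
  obtain ⟨p, hp, hsel⟩ := exists_ge_of_sum_mul_le s good hsub hgood e (fun i => Real.sqrt (Zc i * Pc i))
    (fun i _ => Real.sqrt_nonneg _) hw1 (fun i hi => he0 i (hsub hi)) hE hκW
  refine ⟨p, hp, ?_⟩
  -- `κ W − E σ W ≤ κ W − E Σ_bad w ≤ e_p W`, divide by `W > 0`
  have hbad : E * ∑ i ∈ s \ good, Real.sqrt (Zc i * Pc i) ≤ E * (σ * Real.sqrt (Z * P)) :=
    mul_le_mul_of_nonneg_left hσ hE0
  have hfin : (κ - E * σ) * Real.sqrt (Z * P) ≤ e p * Real.sqrt (Z * P) := by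
    calc (κ - E * σ) * Real.sqrt (Z * P) = κ * Real.sqrt (Z * P) - E * (σ * Real.sqrt (Z * P)) := by ring
      _ ≤ κ * Real.sqrt (Z * P) - E * ∑ i ∈ s \ good, Real.sqrt (Zc i * Pc i) := by linarith
      _ ≤ e p * Real.sqrt (Z * P) := hsel
  exact le_of_mul_le_mul_right hfin hW

end Summit.NavierStokesRegularity.NavierStokesRegularity.Theorems.NearExtremalTransiencePerFlow.MemberSelection
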